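import Mathlib
import HarnessLib

/-!
# The oscillatory Jacobi lemma: a Jacobi field with an exact-derivative tidal term stays near free motion

Topic `Literature/Analysis/ODE` (Grönwall-type a priori bounds; cf. `IntegralGronwall.lean`,
`LiouvilleGreenOscillatory.lean`).  Topical home (librarian move, standing duty B, 2026-08-17) of the
statement formerly filed by the gate as the named fact `Literature.Uncategorized.OscillatoryJacobi`
(relocated from a `FinalStateConjecture` route proposal) and of its proof
`Literature.Uncategorized.OscillatoryJacobi_holds` (`Uncategorized/OscillatoryJacobiProofs.lean`, now a
one-line consequence of this file).  Everything here is **proved**; no definitions, no named facts.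

* `oscillatoryJacobi_bound` — for `C²` functions `a J : ℝ → ℝ` with `|a′| ≤ δ ≤ 1` on `[0,1]` and
  `J″ = −a″J` on `[0,1]`, the deviation of `J` from the free motion `J 0 + s (J′ 0 + a′ 0 · J 0)` is at
  most `100 δ (|J 0| + |J′ 0|)` on `[0,1]` (the proof gives `12 δ (…)`).

## Proof (standard Grönwall argument)

With `K := J′ + a′J` one has `K′ = J″ + a″J + a′J′ = a′J′` (the `a″` terms cancel — this is why no hypothesis on
`a″` is needed).  The pair `G := (E, F)`, `E s := J s − (J 0 + s K₀)`, `F := K − K₀`, `K₀ := K 0`, satisfies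
`G 0 = 0` and `‖G′‖ ≤ 2‖G‖ + ε` on `[0,1)` for the sup norm on `ℝ × ℝ`, `ε := δ(|J 0| + 2|K₀|)`; Mathlib's
`norm_le_gronwallBound_of_norm_deriv_right_le` gives `‖G s‖ ≤ (ε/2)(e^{2s} − 1) ≤ 4ε ≤ 12 δ(|J 0| + |J′ 0|)`,
well inside the stated constant `100`.

## References

Folklore (Grönwall's inequality for linear first-order systems; e.g. P. Hartman, *Ordinary Differential
Equations* (1964), Ch. III §1, and `Mathlib.Analysis.ODE.Gronwall`).
-/

namespace Literature.Analysis.ODE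

open Set

/-- **The oscillatory Jacobi lemma** (standard Grönwall argument): for `C²` functions `a J : ℝ → ℝ` with
`|a′| ≤ δ ≤ 1` on `[0,1]` and `J″ = −a″J` on `[0,1]` (a Jacobi field driven by a tidal potential that is an
EXACT second derivative), `J` stays `100·δ·(|J 0| + |J′ 0|)`-close to the free motion
`J 0 + s·(J′ 0 + a′ 0·J 0)` on `[0,1]`, with NO hypothesis on `a″`.

Write `K := J′ + a′J` and `K₀ := K 0 = J′ 0 + a′ 0 · J 0`.  Using the equation `J″ = −a″J` one gets
`K′ = J″ + a″J + a′J′ = a′J′`, so the pair `G := (E, F)` with `E s := J s − (J 0 + s K₀)` (deviation from the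
free motion) and `F := K − K₀` satisfies `G 0 = 0` and, on `[0,1)` (where `|a′| ≤ δ ≤ 1`, `|s| ≤ 1`),
`‖G′‖ ≤ 2‖G‖ + ε` with `ε := δ (|J 0| + 2|K₀|)` for the sup norm on `ℝ × ℝ`
(`E′ = F − a′J`, `F′ = a′J′ = a′(F + K₀ − a′J)`, `J = E + J 0 + sK₀`).  Grönwall
(`norm_le_gronwallBound_of_norm_deriv_right_le`) gives `‖G s‖ ≤ (ε/2)(e^{2s} − 1) ≤ 4ε`, and
`|K₀| ≤ |J′ 0| + |J 0|` turns this into `|E s| ≤ 12 δ (|J 0| + |J′ 0|) ≤ 100 δ (|J 0| + |J′ 0|)`. [folklore] -/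
theorem oscillatoryJacobi_bound :
    ∀ (a J : ℝ → ℝ) (δ : ℝ), δ ∈ Icc (0 : ℝ) 1 → ContDiff ℝ 2 a → ContDiff ℝ 2 J →
      (∀ s ∈ Icc (0 : ℝ) 1, |deriv a s| ≤ δ) →
      (∀ s ∈ Icc (0 : ℝ) 1, iteratedDeriv 2 J s = -(iteratedDeriv 2 a s) * J s) →
      ∀ s ∈ Icc (0 : ℝ) 1,
        |J s - (J 0 + s * (deriv J 0 + deriv a 0 * J 0))| ≤ 100 * δ * (|J 0| + |deriv J 0|) := by
  intro a J δ hδ ha hJ hda hJ'' s hs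
  obtain ⟨hδ0, hδ1⟩ := hδ
  -- first and second derivatives exist everywhere
  have hJ1 : Differentiable ℝ J := hJ.differentiable (by norm_num)
  have ha2 : Differentiable ℝ (deriv a) := ha.differentiable_deriv_two
  have hJ2 : Differentiable ℝ (deriv J) := hJ.differentiable_deriv_two
  have h2a : iteratedDeriv 2 a = deriv (deriv a) := by
    rw [iteratedDeriv_succ, iteratedDeriv_one]
  have h2J : iteratedDeriv 2 J = deriv (deriv J) := by
    rw [iteratedDeriv_succ, iteratedDeriv_one]
  -- the Jacobi equation in terms of `deriv (deriv J)`
  have hODE : ∀ x ∈ Icc (0 : ℝ) 1, deriv (deriv J) x = -(deriv (deriv a) x) * J x := by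
    intro x hx
    have h := hJ'' x hx
    rwa [h2J, h2a] at h
  -- `K₀ := K 0` where `K := J' + a' J`
  set K0 : ℝ := deriv J 0 + deriv a 0 * J 0 with hK0
  -- deviation from the free motion, `K - K₀`, the pair and its derivative
  set E : ℝ → ℝ := fun x => J x - (J 0 + x * K0) with hE
  set F : ℝ → ℝ := fun x => deriv J x + deriv a x * J x - K0 with hF
  set G : ℝ → ℝ × ℝ := fun x => (E x, F x) with hG
  set G' : ℝ → ℝ × ℝ := fun x => (deriv J x - K0, deriv a x * deriv J x) with hG'
  -- `G` is differentiable with derivative `G'` on `[0,1)` (this is where `J'' = -a'' J` enters)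
  have hGder : ∀ x ∈ Ico (0 : ℝ) 1, HasDerivAt G (G' x) x := by
    intro x hx
    have hxI : x ∈ Icc (0 : ℝ) 1 := Ico_subset_Icc_self hx
    have h3 : HasDerivAt J (deriv J x) x := (hJ1 x).hasDerivAt
    have hE' : HasDerivAt E (deriv J x - K0) x := by
      have h2 : HasDerivAt (fun y : ℝ => J 0 + y * K0) K0 x := (hasDerivAt_mul_const K0).const_add (J 0)
      exact h3.sub h2
    have hF' : HasDerivAt F (deriv a x * deriv J x) x := by
      have h1 : HasDerivAt (deriv J) (deriv (deriv J) x) x := (hJ2 x).hasDerivAt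
      have h2 : HasDerivAt (deriv a) (deriv (deriv a) x) x := (ha2 x).hasDerivAt
      have h4 : HasDerivAt (fun y => deriv J y + deriv a y * J y - K0)
          (deriv (deriv J) x + (deriv (deriv a) x * J x + deriv a x * deriv J x)) x :=
        (h1.add (h2.mul h3)).sub_const K0
      have h5 : deriv (deriv J) x + (deriv (deriv a) x * J x + deriv a x * deriv J x)
          = deriv a x * deriv J x := by
        rw [hODE x hxI]
        ring
      rw [h5] at h4
      exact h4
    exact hE'.prodMk hF'
  -- `G` is continuous on `[0,1]`
  have hGcont : ContinuousOn G (Icc 0 1) := by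
    have hcJ : Continuous J := hJ1.continuous
    have hcJ' : Continuous (deriv J) := hJ2.continuous
    have hca' : Continuous (deriv a) := ha2.continuous
    have hcE : Continuous E := hcJ.sub (continuous_const.add (continuous_id.mul continuous_const))
    have hcF : Continuous F := (hcJ'.add (hca'.mul hcJ)).sub continuous_const
    exact (hcE.prodMk hcF).continuousOn
  -- `G 0 = 0`
  have hG0 : ‖G 0‖ ≤ 0 := by
    have hE0 : E 0 = 0 := by simp only [hE]; ring
    have hF0 : F 0 = 0 := by simp only [hF, hK0]; ring
    have h0 : G 0 = 0 := Prod.ext hE0 hF0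
    rw [h0, norm_zero]
  -- sizes of the data
  have hK0le : |K0| ≤ |J 0| + |deriv J 0| := by
    have h1 : |deriv a 0 * J 0| ≤ |J 0| := by
      rw [abs_mul]
      calc |deriv a 0| * |J 0| ≤ 1 * |J 0| := by
            gcongr
            exact (hda 0 ⟨le_rfl, zero_le_one⟩).trans hδ1
        _ = |J 0| := one_mul _
    calc |K0| = |deriv J 0 + deriv a 0 * J 0| := rfl
      _ ≤ |deriv J 0| + |deriv a 0 * J 0| := abs_add_le _ _
      _ ≤ |J 0| + |deriv J 0| := by linarith
  have hδ2 : δ * δ ≤ δ := by nlinarith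
  set ε : ℝ := δ * (|J 0| + 2 * |K0|) with hε
  have hε0 : 0 ≤ ε := by positivity
  -- the differential inequality `‖G'‖ ≤ 2 ‖G‖ + ε` on `[0,1)`
  have hbound : ∀ x ∈ Ico (0 : ℝ) 1, ‖G' x‖ ≤ 2 * ‖G x‖ + ε := by
    intro x hx
    have hxI : x ∈ Icc (0 : ℝ) 1 := Ico_subset_Icc_self hx
    have hax : |deriv a x| ≤ δ := hda x hxI
    have hEx : |E x| ≤ ‖G x‖ := norm_fst_le (G x)
    have hFx : |F x| ≤ ‖G x‖ := norm_snd_le (G x)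
    have hGx : 0 ≤ ‖G x‖ := norm_nonneg _
    have h3 : δ * ‖G x‖ ≤ ‖G x‖ := mul_le_of_le_one_left hGx hδ1
    -- `J` and `J'` in terms of `E`, `F`
    have hJx : J x = E x + J 0 + x * K0 := by simp only [hE]; ring
    have hJ'x : deriv J x - K0 = F x - deriv a x * J x := by simp only [hF]; ring
    have hJ'x' : deriv J x = F x + K0 - deriv a x * J x := by simp only [hF]; ring
    have hJabs : |J x| ≤ ‖G x‖ + |J 0| + |K0| := by
      have hxK : |x * K0| ≤ |K0| := by
        rw [abs_mul]
        calc |x| * |K0| ≤ 1 * |K0| := by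
              gcongr
              exact abs_le.2 ⟨by linarith [hx.1], hx.2.le⟩
          _ = |K0| := one_mul _
      rw [hJx]
      calc |E x + J 0 + x * K0| ≤ |E x| + |J 0| + |x * K0| := abs_add_three _ _ _
        _ ≤ ‖G x‖ + |J 0| + |K0| := by linarith
    have haJ : |deriv a x| * |J x| ≤ δ * (‖G x‖ + |J 0| + |K0|) :=
      mul_le_mul hax hJabs (abs_nonneg _) hδ0
    change max |deriv J x - K0| |deriv a x * deriv J x| ≤ 2 * ‖G x‖ + ε
    apply max_le
    · -- first component: `E' = F - a' J`
      calc |deriv J x - K0| = |F x - deriv a x * J x| := by rw [hJ'x]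
        _ ≤ |F x| + |deriv a x * J x| := abs_sub _ _
        _ = |F x| + |deriv a x| * |J x| := by rw [abs_mul]
        _ ≤ ‖G x‖ + δ * (‖G x‖ + |J 0| + |K0|) := add_le_add hFx haJ
        _ ≤ 2 * ‖G x‖ + ε := by
          rw [hε]; nlinarith [mul_nonneg hδ0 (abs_nonneg K0)]
    · -- second component: `F' = a' J' = a' (F + K₀ - a' J)`
      have hJ'abs : |deriv J x| ≤ ‖G x‖ + |K0| + δ * (‖G x‖ + |J 0| + |K0|) := by
        rw [hJ'x']
        calc |F x + K0 - deriv a x * J x| ≤ |F x + K0| + |deriv a x * J x| := abs_sub _ _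
          _ ≤ |F x| + |K0| + |deriv a x| * |J x| := by rw [abs_mul]; linarith [abs_add_le (F x) K0]
          _ ≤ ‖G x‖ + |K0| + δ * (‖G x‖ + |J 0| + |K0|) := by linarith
      have i1 : δ * δ * ‖G x‖ ≤ δ * ‖G x‖ := mul_le_mul_of_nonneg_right hδ2 hGx
      have i2 : δ * δ * |J 0| ≤ δ * |J 0| := mul_le_mul_of_nonneg_right hδ2 (abs_nonneg _)
      have i3 : δ * δ * |K0| ≤ δ * |K0| := mul_le_mul_of_nonneg_right hδ2 (abs_nonneg _)
      calc |deriv a x * deriv J x| = |deriv a x| * |deriv J x| := abs_mul _ _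
        _ ≤ δ * (‖G x‖ + |K0| + δ * (‖G x‖ + |J 0| + |K0|)) :=
          mul_le_mul hax hJ'abs (abs_nonneg _) hδ0
        _ ≤ 2 * ‖G x‖ + ε := by rw [hε]; nlinarith
  -- Grönwall
  have hGron := norm_le_gronwallBound_of_norm_deriv_right_le (f := G) (f' := G') (a := 0) (b := 1)
    hGcont (fun x hx => (hGder x hx).hasDerivWithinAt) hG0 hbound s hs
  simp only [gronwallBound_of_K_ne_0 (by norm_num : (2 : ℝ) ≠ 0), sub_zero, zero_mul, zero_add] at hGron
  -- numerical evaluation of the bound: `e^{2s} ≤ e² < 9`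
  have hexp : Real.exp (2 * s) ≤ 9 := by
    have h1 : Real.exp (2 * s) ≤ Real.exp (1 + 1) := Real.exp_le_exp.2 (by linarith [hs.2])
    rw [Real.exp_add] at h1
    nlinarith [Real.exp_one_lt_three, Real.exp_pos 1]
  have hEs : |E s| ≤ ‖G s‖ := norm_fst_le (G s)
  calc |J s - (J 0 + s * K0)| = |E s| := rfl
    _ ≤ ‖G s‖ := hEs
    _ ≤ ε / 2 * (Real.exp (2 * s) - 1) := hGron
    _ ≤ ε / 2 * 8 := mul_le_mul_of_nonneg_left (by linarith) (by linarith)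
    _ = 4 * (δ * (|J 0| + 2 * |K0|)) := by rw [hε]; ring
    _ ≤ 4 * (δ * (|J 0| + 2 * (|J 0| + |deriv J 0|))) := by gcongr
    _ ≤ 100 * δ * (|J 0| + |deriv J 0|) := by
      nlinarith [mul_nonneg hδ0 (abs_nonneg (J 0)), mul_nonneg hδ0 (abs_nonneg (deriv J 0))]

end Literature.Analysis.ODE
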